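import Literature.AlgebraicGeometry.AbelianSchemes.AbelianSchemeFibreAlongIntegralPoint
import Literature.AlgebraicGeometry.AbelianSchemes.AbelianSchemeFixedPowBaseChange
import HarnessLib

/-!
# The NAMED two-presentation isomorphism of a fibre along an integral point, with its laws
# ([SerreTate1968] §1; [MumfordFogartyKirwan1994] Ch. 7 §2 Def. 7.2; [GortzWedhorn2020] (4.7), (4.15))

Topic `AlgebraicGeometry/AbelianSchemes`; namespace `Literature.AlgebraicGeometry.AbelianSchemes.AbelianSchemeOver`.  Two DEFINITIONS
(`fibreAlongIso`, `fibreAlongXIso`) and their laws; no instance, no notation, no named fact, no `sorry`.  Cell `pub/hodgecm-mathlib`,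
programme P6 «MOD» (crux hLiu418 = stmt-HodgeConjecture-24832, `--supports`, count-neutral).

WHY THIS FILE.  ★ (d5) `exists_iso_fibre_baseChange_of_comp_eq` and ★ (DT) `IdealTorsion.exists_equivariant_iso_baseChange_baseChange_of_comp_eq`
state the isomorphism `(𝒜 ×_T U)_y ≅ (𝒜 ×_T V)_u` (for `y ≫ j = u ≫ x̃`) EXISTENTIALLY; a consumer that `.choose`s it (the L2 leaflet's
`isoSpecialOf`∕`isoGenericOf`) obtains an isomorphism known only to be an equivariant homomorphism — which does NOT pin it (an
`𝒪`-equivariant automorphism of the fibre may move non-characteristic finite subgroup schemes), so statements made through the chosen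
isomorphism cannot be compared with statements made through the canonical one (e.g. the kernel rows of ★
`RoofLegsSpecialFibreKernelRows`, which read fibres through the explicit three-piece isomorphism).  This file NAMES the canonical isomorphism
`fibreAlongIso j x̃ 𝒜 h := fibreBaseChangeIso ≪≫ fibreCongrPtIso h ≪≫ fibreBaseChangeIso⁻¹` (exactly the witness of ★ (d5)) and its
`Over`-level packaging `fibreAlongXIso` (exactly the witness of ★ (DT)), and records ∃-free: (i) `hom` is a homomorphism, (ii) it
intertwines base-changed ring actions, (iii) it carries the value at `y` of every pulled-back section to the value at `u` (the law a
chosen isomorphism cannot have), (iv) naturality in homomorphisms `f : 𝒜 → ℬ` over `T`.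

## Mathematics

For an abelian scheme `𝒜 → T`, morphisms `j : U → T`, `x̃ : V → T` and field-valued points `y : Spec L → U`, `u : Spec L → V` with
`h : y ≫ j = u ≫ x̃`, the fibres `(𝒜 ×_T U)_y` and `(𝒜 ×_T V)_u` are both canonically `𝒜_{y ≫ j} = 𝒜_{u ≫ x̃}`; the composite of the
canonical identifications is an isomorphism of abelian varieties over `L`, natural in `𝒜` and compatible with sections
[GortzWedhorn2020, (4.7), Prop. 4.16], [MumfordFogartyKirwan1994, Ch. 7 §2 Def. 7.2].

* §1 `fibreAlongIso` + `map_fibreAlongIso_hom_restrictPt` (sections) + `fibreHom_comp_fibreAlongIso_hom` (naturality);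
* §2 `fibreAlongXIso` (the `Over`-level isomorphism `((𝒜 ×_T U) ×_U y).X ≅ ((𝒜 ×_T V) ×_V u).X`) + `fibreAlongXIso_hom`∕`_inv` (`rfl`) +
  `isMonHom_fibreAlongXIso_hom` + `baseChange_i_comp_fibreAlongXIso_hom` (equivariance for a ring action `ρ`) +
  `map_fibreAlongXIso_hom_restrictPt` (sections) + `baseChangeHom_comp_fibreAlongXIso_hom` (naturality, `Over` level).

HC_CM is proved only modulo the printed citations (2 remaining named inputs hLiu418 24832, h413 24833) until rung 0 closes; this file is
generic and changes no count.

## References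
* [SerreTate1968] J.-P. Serre, J. Tate, *Good reduction of abelian varieties*, Ann. of Math. 88 (1968), §1 (the reduction map).
* [MumfordFogartyKirwan1994] D. Mumford, J. Fogarty, F. Kirwan, *Geometric Invariant Theory* (3rd ed., 1994), Ch. 7 §2 Definition 7.2 (p. 129).
* [GortzWedhorn2020] U. Görtz, T. Wedhorn, *Algebraic Geometry I* (2nd ed., 2020), Section (4.7) (p. 135), Prop. 4.16, Section (4.15) (p. 116).
-/

set_option autoImplicit false

noncomputable section

-- `(specOver K Ω).left = Spec Ω`, `(Over.mk f).left` etc. are definitional only above `instances` transparency (as in ★ (d1)–(d5)).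
set_option backward.isDefEq.respectTransparency false

universe u

open CategoryTheory CategoryTheory.Limits AlgebraicGeometry

namespace Literature.AlgebraicGeometry.AbelianSchemes

namespace AbelianSchemeOver

open Literature.AlgebraicGeometry.Motives
open scoped MonObj

variable {T U V : Scheme.{u}} (j : U ⟶ T) (xt : V ⟶ T) {L : Type u} [Field L] {y : Spec (.of L) ⟶ U}
  {u : Spec (.of L) ⟶ V} (𝒜 : AbelianSchemeOver T)

/-! ## §1 The named isomorphism of abelian varieties and its two laws -/

/-- **`fibreAlongIso j x̃ 𝒜 h : (𝒜 ×_T U)_y ≅ (𝒜 ×_T V)_u`** for `h : y ≫ j = u ≫ x̃` — the composite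
`fibreBaseChangeIso ≪≫ fibreCongrPtIso h ≪≫ fibreBaseChangeIso⁻¹` of the canonical identifications with `𝒜_{y ≫ j} = 𝒜_{u ≫ x̃}` (the witness of ★ (d5)
`exists_iso_fibre_baseChange_of_comp_eq`, now NAMED). [cite: GortzWedhorn2020, Section (4.7) (p. 135), Prop. 4.16] [cite: MumfordFogartyKirwan1994, Ch. 7 §2 Definition 7.2 (p. 129)] -/
def fibreAlongIso (h : y ≫ j = u ≫ xt) :
    ((𝒜.baseChange j).fibre y).toAbelianVariety ≅ ((𝒜.baseChange xt).fibre u).toAbelianVariety :=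
  𝒜.fibreBaseChangeIso j y ≪≫ 𝒜.fibreCongrPtIso h ≪≫ (𝒜.fibreBaseChangeIso xt u).symm

/-- For an isomorphism `φ : X ≅ Y` of abelian varieties: if `φ` carries `P` to `Q` then `φ⁻¹` carries `Q` to `P`. [cite: GortzWedhorn2020, Section (4.7) (p. 135)] -/
private theorem map_inv_eq_of_map_hom_eq_iso {K : Type u} [Field K] {X Y : AbelianVariety K} (φ : X ≅ Y) {Ω : Type u} [Field Ω]
    [Algebra K Ω] {P : AlgPoints X.X Ω} {Q : AlgPoints Y.X Ω} (hPQ : AlgPoints.map φ.hom.hom.hom.hom P = Q) :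
    AlgPoints.map φ.inv.hom.hom.hom Q = P := by
  rw [← hPQ]
  change (P ≫ φ.hom.hom.hom.hom) ≫ φ.inv.hom.hom.hom = P
  have hφ : φ.hom.hom.hom.hom ≫ φ.inv.hom.hom.hom = 𝟙 _ := congrArg (fun ψ => ψ.hom.hom.hom) φ.hom_inv_id
  rw [Category.assoc, hφ, Category.comp_id]

/-- **SECTIONS LAW**: `fibreAlongIso` carries the value at `y` of the pulled-back section `τ ×_T U` to the value at `u` of `τ ×_T V` (★ (d5) clause (i), for the
NAMED isomorphism). [cite: MumfordFogartyKirwan1994, Ch. 7 §2 Definition 7.2 (p. 129)] [cite: GortzWedhorn2020, Section (4.7) (p. 135)] -/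
theorem map_fibreAlongIso_hom_restrictPt (h : y ≫ j = u ≫ xt) (τ : 𝒜.Sections) :
    AlgPoints.map (𝒜.fibreAlongIso j xt h).hom.hom.hom.hom ((𝒜.baseChange j).restrictPt y (𝒜.sectionBaseChange j τ)) =
      (𝒜.baseChange xt).restrictPt u (𝒜.sectionBaseChange xt τ) := by
  have h3 : AlgPoints.map (𝒜.fibreBaseChangeIso xt u).inv.hom.hom.hom (𝒜.restrictPt (u ≫ xt) τ) =
      (𝒜.baseChange xt).restrictPt u (𝒜.sectionBaseChange xt τ) :=
    map_inv_eq_of_map_hom_eq_iso (𝒜.fibreBaseChangeIso xt u) (𝒜.map_fibreBaseChangeIso_restrictPt_sectionBaseChange xt u τ)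
  calc AlgPoints.map (𝒜.fibreBaseChangeIso j y ≪≫ 𝒜.fibreCongrPtIso h ≪≫ (𝒜.fibreBaseChangeIso xt u).symm).hom.hom.hom.hom
        ((𝒜.baseChange j).restrictPt y (𝒜.sectionBaseChange j τ))
      = AlgPoints.map (𝒜.fibreBaseChangeIso xt u).inv.hom.hom.hom
          (AlgPoints.map (𝒜.fibreCongrPtIso h).hom.hom.hom.hom
            (AlgPoints.map (𝒜.fibreBaseChangeIso j y).hom.hom.hom.hom
              ((𝒜.baseChange j).restrictPt y (𝒜.sectionBaseChange j τ)))) := by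
          simp only [AlgPoints.map_apply, Iso.trans_hom, Iso.symm_hom, AbelianVariety.comp_hom, Category.assoc]
          rfl
    _ = (𝒜.baseChange xt).restrictPt u (𝒜.sectionBaseChange xt τ) := by
          rw [𝒜.map_fibreBaseChangeIso_restrictPt_sectionBaseChange j y τ, 𝒜.map_fibreCongrPtIso_restrictPt h τ, h3]

/-- **NATURALITY LAW**: for a homomorphism `f : 𝒜 → ℬ` over `T`, `(f ×_T U)_y ≫ fibreAlongIso ℬ = fibreAlongIso 𝒜 ≫ (f ×_T V)_u` (★ (d5) clause (ii), for the NAMED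
isomorphism). [cite: GortzWedhorn2020, Section (4.7) (p. 135), Prop. 4.16] -/
theorem fibreHom_comp_fibreAlongIso_hom (h : y ≫ j = u ≫ xt) (ℬ : AbelianSchemeOver T) (f : 𝒜.X ⟶ ℬ.X) [IsMonHom f] :
    haveI := isMonHom_baseChangeHom f j
    haveI := isMonHom_baseChangeHom f xt
    fibreHom (baseChangeHom f j) y ≫ (ℬ.fibreAlongIso j xt h).hom = (𝒜.fibreAlongIso j xt h).hom ≫ fibreHom (baseChangeHom f xt) u := by
  haveI := isMonHom_baseChangeHom f j
  haveI := isMonHom_baseChangeHom f xt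
  simp only [fibreAlongIso, Iso.trans_hom, Iso.symm_hom]
  rw [← Category.assoc, fibreHom_baseChangeHom_comp_fibreBaseChangeIso_hom, Category.assoc, ← Category.assoc (fibreHom f _),
    fibreHom_comp_fibreCongrPtIso_hom, Category.assoc, fibreHom_comp_fibreBaseChangeIso_inv, Category.assoc, Category.assoc]

/-! ## §2 The `Over`-level packaging and its laws (homomorphism, equivariance, sections, naturality) -/

/-- **`fibreAlongXIso j x̃ 𝒜 h : ((𝒜 ×_T U) ×_U y).X ≅ ((𝒜 ×_T V) ×_V u).X`** — the same isomorphism on the underlying objects over `Spec L` (the witness of ★ (DT)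
`exists_equivariant_iso_baseChange_baseChange_of_comp_eq`, now NAMED). [cite: GortzWedhorn2020, Section (4.15) (p. 116)] -/
def fibreAlongXIso (h : y ≫ j = u ≫ xt) : ((𝒜.baseChange j).baseChange y).X ≅ ((𝒜.baseChange xt).baseChange u).X :=
  ⟨(𝒜.fibreAlongIso j xt h).hom.hom.hom.hom, (𝒜.fibreAlongIso j xt h).inv.hom.hom.hom,
    congrArg (fun ψ => ψ.hom.hom.hom) (𝒜.fibreAlongIso j xt h).hom_inv_id,
    congrArg (fun ψ => ψ.hom.hom.hom) (𝒜.fibreAlongIso j xt h).inv_hom_id⟩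

/-- `(fibreAlongXIso …).hom` is the underlying morphism of `(fibreAlongIso …).hom` (`rfl`). [cite: GortzWedhorn2020, Section (4.15) (p. 116)] -/
theorem fibreAlongXIso_hom (h : y ≫ j = u ≫ xt) : (𝒜.fibreAlongXIso j xt h).hom = (𝒜.fibreAlongIso j xt h).hom.hom.hom.hom := rfl

/-- `(fibreAlongXIso …).inv` is the underlying morphism of `(fibreAlongIso …).inv` (`rfl`). [cite: GortzWedhorn2020, Section (4.15) (p. 116)] -/
theorem fibreAlongXIso_inv (h : y ≫ j = u ≫ xt) : (𝒜.fibreAlongXIso j xt h).inv = (𝒜.fibreAlongIso j xt h).inv.hom.hom.hom := rfl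

/-- **HOMOMORPHISM LAW**: `(fibreAlongXIso …).hom` is a homomorphism of group objects. [cite: GortzWedhorn2020, Section (4.15) (p. 116)] -/
theorem isMonHom_fibreAlongXIso_hom (h : y ≫ j = u ≫ xt) : IsMonHom (𝒜.fibreAlongXIso j xt h).hom := by
  rw [fibreAlongXIso_hom]; infer_instance

/-- **HOMOMORPHISM LAW** for the inverse. [cite: GortzWedhorn2020, Section (4.15) (p. 116)] -/
theorem isMonHom_fibreAlongXIso_inv (h : y ≫ j = u ≫ xt) : IsMonHom (𝒜.fibreAlongXIso j xt h).inv := by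
  rw [fibreAlongXIso_inv]; infer_instance

/-- **NATURALITY LAW, `Over` level**: `(f ×_T U) ×_U y ≫ fibreAlongXIso ℬ = fibreAlongXIso 𝒜 ≫ (f ×_T V) ×_V u` for a homomorphism `f : 𝒜 → ℬ` over `T`
(★ `fibreHom_hom_hom_hom`, `rfl`). [cite: GortzWedhorn2020, Section (4.7) (p. 135), Prop. 4.16] -/
theorem baseChangeHom_comp_fibreAlongXIso_hom (h : y ≫ j = u ≫ xt) (ℬ : AbelianSchemeOver T) (f : 𝒜.X ⟶ ℬ.X) [IsMonHom f] :
    haveI := isMonHom_baseChangeHom f j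
    haveI := isMonHom_baseChangeHom f xt
    baseChangeHom (baseChangeHom f j) y ≫ (ℬ.fibreAlongXIso j xt h).hom = (𝒜.fibreAlongXIso j xt h).hom ≫ baseChangeHom (baseChangeHom f xt) u :=
  congrArg (fun ψ => ψ.hom.hom.hom) (𝒜.fibreHom_comp_fibreAlongIso_hom j xt h ℬ f)

/-- **EQUIVARIANCE LAW**: `fibreAlongXIso` intertwines the base-changed actions `((ρ ×_T U) ×_U y).i a` and `((ρ ×_T V) ×_V u).i a` of a ring action `ρ` on `𝒜`
(naturality at `f := ρ.i a`; ★ `RingAction.baseChange_i`, `rfl`). [cite: GortzWedhorn2020, Section (4.7) (p. 135) and Section (4.15) (p. 116)] -/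
theorem baseChange_i_comp_fibreAlongXIso_hom (h : y ≫ j = u ≫ xt) {O : Type*} [CommRing O] (ρ : 𝒜.RingAction O) (a : O) :
    ((ρ.baseChange j).baseChange y).i a ≫ (𝒜.fibreAlongXIso j xt h).hom = (𝒜.fibreAlongXIso j xt h).hom ≫ ((ρ.baseChange xt).baseChange u).i a := by
  haveI := ρ.isMonHom a
  exact congrArg (fun ψ => ψ.hom.hom.hom) (𝒜.fibreHom_comp_fibreAlongIso_hom j xt h 𝒜 (ρ.i a))

/-- **SECTIONS LAW, `Over` level**: `fibreAlongXIso` carries the `L`-point `(τ ×_T U)(y)` to `(τ ×_T V)(u)`. [cite: MumfordFogartyKirwan1994, Ch. 7 §2 Definition 7.2 (p. 129)] -/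
theorem map_fibreAlongXIso_hom_restrictPt (h : y ≫ j = u ≫ xt) (τ : 𝒜.Sections) :
    AlgPoints.map (𝒜.fibreAlongXIso j xt h).hom ((𝒜.baseChange j).restrictPt y (𝒜.sectionBaseChange j τ)) =
      (𝒜.baseChange xt).restrictPt u (𝒜.sectionBaseChange xt τ) :=
  𝒜.map_fibreAlongIso_hom_restrictPt j xt h τ

/-- **SECTIONS LAW for the inverse**: `fibreAlongXIso⁻¹` carries `(τ ×_T V)(u)` back to `(τ ×_T U)(y)`. [cite: MumfordFogartyKirwan1994, Ch. 7 §2 Definition 7.2 (p. 129)] -/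
theorem map_fibreAlongXIso_inv_restrictPt (h : y ≫ j = u ≫ xt) (τ : 𝒜.Sections) :
    AlgPoints.map (𝒜.fibreAlongXIso j xt h).inv ((𝒜.baseChange xt).restrictPt u (𝒜.sectionBaseChange xt τ)) =
      (𝒜.baseChange j).restrictPt y (𝒜.sectionBaseChange j τ) :=
  map_inv_eq_of_map_hom_eq_iso (𝒜.fibreAlongIso j xt h) (𝒜.map_fibreAlongIso_hom_restrictPt j xt h τ)

end AbelianSchemeOver

end Literature.AlgebraicGeometry.AbelianSchemes

end
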